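import Mathlib
import Summits.Ventures.Crystal3D.Theorems.StickyWulffConstantTextureLiminfTexShadowFluxDefs
import HarnessLib

/-!
# Line `TexShadow` for the crux `TextureLiminf` (stmt-Ventures-19483) — IN-LAYER (straight-line) FLUX vocabulary
# (LAYER-FLUX chain, booked cf-p1 ROUTE.md §86(72) BO for wulff-p2; shrinks the zigzag-deficit stub)

HONEST FRAMING. Part of the venture `Summits/Ventures/Crystal3D` (cell `crystal3d-full`), route
`route-Ventures-StickyWulffConstant`, crux `TextureLiminf` (stmt-Ventures-19483), registered line `TexShadow` (v6.7/v6.8).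
Definitions + elementary bounds only; nothing is claimed about the stubs.  Rung credit only; F-C1 not moved.

`…TexShadowFluxDefs` (p641847) measures the INTER-layer zigzag flux of a plate (`bilayerRise`, `plateFlux`).  Every layer
of every Barlow stacking is the same triangular lattice and contains the six INTRA-layer bonds `±u, ±v, ±(u−v)`
(`u = triangularVec₁ 1`, `v = triangularVec₂ 1`, model coordinates): straight walker lines inside each layer, one per
site row, of transversal density `√2` per unit area.  When the cut normal is close to the layer planes these rise faster
than any inter-layer bond.  This file fixes the vocabulary of the second flux:

* `layerRise L e := max (max |⟪u, L⁻¹e⟫| |⟪v, L⁻¹e⟫|) |⟪u − v, L⁻¹e⟫|` — the best e-component of the six in-layer bonds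
  (word-independent); `bestLayerDir L e` — a maximising SIGNED in-layer bond, `inner_bestLayerDir`, `norm_bestLayerDir`,
  `bestLayerDir_apply_two` (= 0: it is horizontal in the model), `bestLayerDir_mem` (it is `±u, ±v, ±(u−v)`);
* `layerRise_nonneg`, `layerRise_le_one` (‖e‖ = 1), `half_lateral_sq_le_layerRise_sq` (`(ν₀²+ν₁²)/2 ≤ layerRise²`);
* `layerFlux τ L e := if τ ≤ layerRise L e then √2 · layerRise L e else 0` (launchable at steepness `τ`), `layerFlux_nonneg`,
  `layerFlux_le_sqrt_two`.
The combined domination predicate (SUM or MAX with `plateFlux`, cf-p1 §86(72) BO pending 19480-p2) is NOT fixed here.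
WHAT THIS IS NOT: not the in-layer line count; F-C1 not moved.
-/

noncomputable section

open scoped InnerProductSpace

namespace Summit.Ventures.Crystal3D.Cruxes.TextureLiminf.TexShadow

open Literature.MathematicalPhysics.StatisticalMechanics (triangularVec₁ triangularVec₂)

/-! ## The in-layer rise and flux -/

/-- **the IN-LAYER RISE toward `e`** of the stacking with frame `L`: the best e-component of the six intra-layer bonds
`±u, ±v, ±(u − v)` (the same in every layer, for every Hägg word). -/
def layerRise (L : E3 ≃ₗᵢ[ℝ] E3) (e : E3) : ℝ :=
  max (max |⟪triangularVec₁ 1, L.symm e⟫_ℝ| |⟪triangularVec₂ 1, L.symm e⟫_ℝ|)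
    |⟪triangularVec₁ 1 - triangularVec₂ 1, L.symm e⟫_ℝ|

/-- The unsigned best axis among `u, v, u − v`. -/
def bestLayerAxis (L : E3 ≃ₗᵢ[ℝ] E3) (e : E3) : E3 :=
  if |⟪triangularVec₁ 1 - triangularVec₂ 1, L.symm e⟫_ℝ| ≤
      max |⟪triangularVec₁ 1, L.symm e⟫_ℝ| |⟪triangularVec₂ 1, L.symm e⟫_ℝ| then
    (if |⟪triangularVec₂ 1, L.symm e⟫_ℝ| ≤ |⟪triangularVec₁ 1, L.symm e⟫_ℝ| then triangularVec₁ 1 else triangularVec₂ 1)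
  else triangularVec₁ 1 - triangularVec₂ 1

/-- **a best SIGNED in-layer bond toward `e`**: the best axis, oriented e-upward. -/
def bestLayerDir (L : E3 ≃ₗᵢ[ℝ] E3) (e : E3) : E3 :=
  (if 0 ≤ ⟪bestLayerAxis L e, L.symm e⟫_ℝ then (1 : ℝ) else -1) • bestLayerAxis L e

/-- **the IN-LAYER FLUX at steepness `τ`**: `√2 · layerRise` if the in-layer lines are launchable (`τ ≤ layerRise`),
else `0` (sites have density `√2`; each site lies on exactly one line of the best direction). -/
def layerFlux (τ : ℝ) (L : E3 ≃ₗᵢ[ℝ] E3) (e : E3) : ℝ :=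
  if τ ≤ layerRise L e then Real.sqrt 2 * layerRise L e else 0

/-! ## Elementary facts -/

/-- `u`, `v`, `u − v` in coordinates. -/
theorem triangularVec_coords :
    (triangularVec₁ 1 : E3) 0 = 1 ∧ (triangularVec₁ 1 : E3) 1 = 0 ∧ (triangularVec₁ 1 : E3) 2 = 0 ∧
    (triangularVec₂ 1 : E3) 0 = 1 / 2 ∧ (triangularVec₂ 1 : E3) 1 = Real.sqrt 3 / 2 ∧ (triangularVec₂ 1 : E3) 2 = 0 := by
  simp [triangularVec₁, triangularVec₂]

/-- Inner products with `u`, `v`, `u − v` in coordinates. -/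
theorem inner_layerAxes (ν : E3) :
    ⟪(triangularVec₁ 1 : E3), ν⟫_ℝ = ν 0 ∧ ⟪(triangularVec₂ 1 : E3), ν⟫_ℝ = 1 / 2 * ν 0 + Real.sqrt 3 / 2 * ν 1 ∧
    ⟪(triangularVec₁ 1 : E3) - triangularVec₂ 1, ν⟫_ℝ = 1 / 2 * ν 0 - Real.sqrt 3 / 2 * ν 1 := by
  obtain ⟨h10, h11, h12, h20, h21, h22⟩ := triangularVec_coords
  have h1 : ⟪(triangularVec₁ 1 : E3), ν⟫_ℝ = ν 0 := by
    rw [EuclideanSpace.inner_eq_star_dotProduct, dotProduct, Fin.sum_univ_three]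
    simp [h10, h11, h12]
  have h2 : ⟪(triangularVec₂ 1 : E3), ν⟫_ℝ = 1 / 2 * ν 0 + Real.sqrt 3 / 2 * ν 1 := by
    rw [EuclideanSpace.inner_eq_star_dotProduct, dotProduct, Fin.sum_univ_three]
    simp [h20, h21, h22]; ring
  refine ⟨h1, h2, ?_⟩
  rw [inner_sub_left, h1, h2]; ring

/-- The best axis is one of `u, v, u − v` and attains `layerRise` in absolute value. -/
theorem bestLayerAxis_spec (L : E3 ≃ₗᵢ[ℝ] E3) (e : E3) :
    (bestLayerAxis L e = triangularVec₁ 1 ∨ bestLayerAxis L e = triangularVec₂ 1 ∨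
      bestLayerAxis L e = triangularVec₁ 1 - triangularVec₂ 1) ∧
    |⟪bestLayerAxis L e, L.symm e⟫_ℝ| = layerRise L e := by
  unfold bestLayerAxis layerRise
  split_ifs with h1 h2
  · refine ⟨Or.inl rfl, ?_⟩
    rw [max_eq_left h1, max_eq_left h2]
  · refine ⟨Or.inr (Or.inl rfl), ?_⟩
    rw [max_eq_left h1, max_eq_right (le_of_lt (not_le.1 h2))]
  · refine ⟨Or.inr (Or.inr rfl), ?_⟩
    rw [max_eq_right (le_of_lt (not_le.1 h1))]

/-- **The best signed in-layer bond attains the in-layer rise:** `⟪bestLayerDir, L⁻¹ e⟫ = layerRise`. -/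
theorem inner_bestLayerDir (L : E3 ≃ₗᵢ[ℝ] E3) (e : E3) : ⟪bestLayerDir L e, L.symm e⟫_ℝ = layerRise L e := by
  obtain ⟨-, habs⟩ := bestLayerAxis_spec L e
  rw [bestLayerDir, real_inner_smul_left, ← habs]
  split_ifs with h
  · rw [one_mul, abs_of_nonneg h]
  · rw [abs_of_neg (not_le.1 h)]; ring

/-- The axes are unit vectors. -/
theorem norm_layerAxes : ‖(triangularVec₁ 1 : E3)‖ = 1 ∧ ‖(triangularVec₂ 1 : E3)‖ = 1 ∧
    ‖(triangularVec₁ 1 : E3) - triangularVec₂ 1‖ = 1 := by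
  obtain ⟨h10, h11, h12, h20, h21, h22⟩ := triangularVec_coords
  have h3 : Real.sqrt 3 ^ 2 = 3 := Real.sq_sqrt (by norm_num)
  refine ⟨?_, ?_, ?_⟩
  · rw [EuclideanSpace.norm_eq, Fin.sum_univ_three]
    simp [h10, h11, h12]
  · rw [EuclideanSpace.norm_eq, Fin.sum_univ_three]
    simp [h20, h21, h22, div_pow, h3]
    norm_num
  · rw [EuclideanSpace.norm_eq, Fin.sum_univ_three]
    simp [h10, h11, h12, h20, h21, h22, div_pow, h3]
    norm_num

/-- **The best signed in-layer bond is a unit vector.** -/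
theorem norm_bestLayerDir (L : E3 ≃ₗᵢ[ℝ] E3) (e : E3) : ‖bestLayerDir L e‖ = 1 := by
  obtain ⟨hax, -⟩ := bestLayerAxis_spec L e
  obtain ⟨n1, n2, n3⟩ := norm_layerAxes
  have hn : ‖bestLayerAxis L e‖ = 1 := by rcases hax with h | h | h <;> rw [h] <;> assumption
  rw [bestLayerDir, norm_smul, hn, mul_one]
  split_ifs <;> simp

/-- The best in-layer bond is horizontal in the model: `(bestLayerDir L e) 2 = 0`. -/
theorem bestLayerDir_apply_two (L : E3 ≃ₗᵢ[ℝ] E3) (e : E3) : bestLayerDir L e 2 = 0 := by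
  obtain ⟨hax, -⟩ := bestLayerAxis_spec L e
  obtain ⟨-, -, h12, -, -, h22⟩ := triangularVec_coords
  have h2 : bestLayerAxis L e 2 = 0 := by
    rcases hax with h | h | h <;> rw [h]
    · exact h12
    · exact h22
    · rw [PiLp.sub_apply, h12, h22, sub_zero]
  rw [bestLayerDir, PiLp.smul_apply, smul_eq_mul, h2, mul_zero]

/-- **The best signed in-layer bond is a lattice vector of the layer:** `± u`, `± v` or `± (u − v)`, i.e.
`a • u + b • v` with `(a, b) ∈ {(±1, 0), (0, ±1), ±(1, −1)}`. -/
theorem bestLayerDir_mem (L : E3 ≃ₗᵢ[ℝ] E3) (e : E3) : ∃ a b : ℤ,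
    ((a = 1 ∧ b = 0) ∨ (a = -1 ∧ b = 0) ∨ (a = 0 ∧ b = 1) ∨ (a = 0 ∧ b = -1) ∨ (a = 1 ∧ b = -1) ∨ (a = -1 ∧ b = 1)) ∧
    bestLayerDir L e = (a : ℝ) • triangularVec₁ 1 + (b : ℝ) • triangularVec₂ 1 := by
  obtain ⟨hax, -⟩ := bestLayerAxis_spec L e
  unfold bestLayerDir
  rcases hax with h | h | h <;> rw [h] <;> split_ifs
  · exact ⟨1, 0, by norm_num, by simp⟩
  · exact ⟨-1, 0, by norm_num, by simp⟩
  · exact ⟨0, 1, by norm_num, by simp⟩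
  · exact ⟨0, -1, by norm_num, by simp⟩
  · exact ⟨1, -1, by norm_num, by simp [sub_eq_add_neg]⟩
  · exact ⟨-1, 1, by norm_num, by simp [sub_eq_add_neg]⟩

/-- `0 ≤ layerRise`. -/
theorem layerRise_nonneg (L : E3 ≃ₗᵢ[ℝ] E3) (e : E3) : 0 ≤ layerRise L e :=
  le_trans (abs_nonneg _) (le_max_right _ _)

/-- **`layerRise ≤ 1`** for a unit normal. -/
theorem layerRise_le_one (L : E3 ≃ₗᵢ[ℝ] E3) {e : E3} (he : ‖e‖ = 1) : layerRise L e ≤ 1 := by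
  have hν : ‖L.symm e‖ = 1 := by rw [LinearIsometryEquiv.norm_map, he]
  obtain ⟨n1, n2, n3⟩ := norm_layerAxes
  have hb : ∀ w : E3, ‖w‖ = 1 → |⟪w, L.symm e⟫_ℝ| ≤ 1 := fun w hw => by
    have := abs_real_inner_le_norm w (L.symm e); rw [hw, hν, one_mul] at this; exact this
  unfold layerRise
  exact max_le (max_le (hb _ n1) (hb _ n2)) (hb _ n3)

/-- **The in-layer rise controls the lateral part of the normal:** `(ν₀² + ν₁²)/2 ≤ layerRise²` (`ν = L⁻¹ e`; the three
axes at 60° see every horizontal direction within 30°… here only the cheap quadratic-mean bound). -/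
theorem half_lateral_sq_le_layerRise_sq (L : E3 ≃ₗᵢ[ℝ] E3) (e : E3) :
    ((L.symm e) 0 ^ 2 + (L.symm e) 1 ^ 2) / 2 ≤ layerRise L e ^ 2 := by
  obtain ⟨h1, h2, h3⟩ := inner_layerAxes (L.symm e)
  have hs3 : Real.sqrt 3 ^ 2 = 3 := Real.sq_sqrt (by norm_num)
  set r := layerRise L e with hr
  have hr0 : 0 ≤ r := layerRise_nonneg L e
  have ha : |⟪(triangularVec₁ 1 : E3), L.symm e⟫_ℝ| ≤ r := le_trans (le_max_left _ _) (le_max_left _ _)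
  have hb : |⟪(triangularVec₂ 1 : E3), L.symm e⟫_ℝ| ≤ r := le_trans (le_max_right _ _) (le_max_left _ _)
  have hc : |⟪(triangularVec₁ 1 : E3) - triangularVec₂ 1, L.symm e⟫_ℝ| ≤ r := le_max_right _ _
  rw [h1] at ha; rw [h2] at hb; rw [h3] at hc
  have ha2 := sq_le_sq' (abs_le.1 ha).1 (abs_le.1 ha).2
  have hb2 := sq_le_sq' (abs_le.1 hb).1 (abs_le.1 hb).2
  have hc2 := sq_le_sq' (abs_le.1 hc).1 (abs_le.1 hc).2
  -- a² + b'² + c'² = (3/2)(ν₀² + ν₁²) and each ≤ r²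
  nlinarith [hs3]

/-- `0 ≤ layerFlux`. -/
theorem layerFlux_nonneg (τ : ℝ) (L : E3 ≃ₗᵢ[ℝ] E3) (e : E3) : 0 ≤ layerFlux τ L e := by
  unfold layerFlux; split_ifs
  · exact mul_nonneg (Real.sqrt_nonneg _) (layerRise_nonneg L e)
  · exact le_rfl

/-- `layerFlux ≤ √2` for a unit normal. -/
theorem layerFlux_le_sqrt_two (τ : ℝ) (L : E3 ≃ₗᵢ[ℝ] E3) {e : E3} (he : ‖e‖ = 1) : layerFlux τ L e ≤ Real.sqrt 2 := by
  unfold layerFlux; split_ifs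
  · exact mul_le_of_le_one_right (Real.sqrt_nonneg _) (layerRise_le_one L he)
  · exact Real.sqrt_nonneg _

end Summit.Ventures.Crystal3D.Cruxes.TextureLiminf.TexShadow

end
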